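import Summits.Ventures.HodgeRepro2.T6N43HostCarriers
import Summits.Ventures.HodgeRepro2.T6N43FockSpace

/-!
# T6N43HostFock — the host-shaped N4.3 bundles with the Fock model FIXED: `E = ℓ²(FockIndex, ℂ)`,
`ι = fockEmbed`, `hι = fockEmbed_Delta_ne_zero`; the §18(c) scalar / weight parameters stay explicit

FILED by seat t6-p6 (gen 19, wave 1; staged gen 15 as continuation-readiness for the RS-N4.3
lane). T6N43HostCarriers (gen 14; filed in WAVE 1, p437619) built `ExplicitU2.host` / `BergmanU11.host` /
`BergmanPlaces.host` on the real carriers `U(2)` (probability Haar) and `U(1,1)` (Haar) with the Fock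
model `(E, ι, hι)` of the compact place and the scalar / weight parameters as explicit arguments;
T6N43FockSpace (gen 15; filed in WAVE 1, p437620) supplies the Fock model in host shape. This file
composes the two:
`ExplicitU2.hostFock` / `BergmanPlaces.hostFock` take ONLY the record's remaining choices — `m = (m′₁ −
3)/2`, the forced-vector scalars `c_j ≠ 0`, the archimedean L-factors `L_j` (re-pointed at the global
datum's factors by the M2 carrier, `withLfac`) and the Eischen–Liu weight / twist parameters `(τ_j, ν_j,
r_j)` on which the displays are consumed — and `BergmanPlaces.hostFock₁` further takes the normalisation
`f = φ` (`c_j = 1`) of R3.7's identification «f_{τ′_j} ↔ φ_{A,τ′_j}» (TIER5 (N4.3.P2); the only use of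
`c_j` in THEOREM N4.3 is `c_j ≠ 0`). On the fixed Fock model the compact place's matrix coefficient is
EXPLICIT: `⟪Δ, ω(g)Δ⟫ = 2 · det(g)^m`, `‖Δ‖ = √2`, `‖cΔ‖ = |c| √2` (`hostFock_coeffW`, `hostFock_normφ`,
`hostFock_normf` — the eigenvector statement `fockActU2_Delta` read on the genuine Fock inner product),
and THEOREM N4.3 (b) at τ′₁ becomes a NUMBER: `Z_{τ′₁}(1/2) = 4 |c|²` (`hostFock_zeta_half`), `= 4` on
the normalised bundle (`hostFock₁_zetaAt_zero`). THEOREM N4.3 (c) on the bundle from the five displays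
alone: `hostFock_archNonvanishing` / `hostFock₁_archNonvanishing`. Nothing
here is a toy transfer to the host datum `M` (the lead's open binder); the file is the host-shaped
`BergmanPlaces` value a host inhabitant of `M.sA.d43` / `M.sB.d43` would be assembled from, with every
remaining choice visible in the signature. Axioms: {propext, Classical.choice, Quot.sound}. §8(d): uses
an L-value-free non-vanishing device: NO.

Filed in Tier-6 WAVE 1 as p438070 (ACCEPTED 2026-08-26T10:28:40Z, commit
0381abbbe46472e70df29fafda01b4421c2f4cb1); this v2 differs from the filed bytes in this module docstring only — the
«(staged)» tags on sibling files, all filed in WAVE 1, replaced by their filing references (the PARK release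
clause, STATUS l. 12943 / l. 13037 (1)); every declaration byte-identical.
-/

namespace Summit.Ventures.HodgeRepro2.T6

open MeasureTheory
open scoped InnerProductSpace

namespace N43Host

/-- The compact place τ′₁ in host shape with the Fock model fixed (`ℓ²(FockIndex, ℂ)`, `fockEmbed`):
the arguments are the integer `m = (m′₁ − 3)/2`, the forced-vector scalar `c ≠ 0`, the L-factor and the
Eischen–Liu parameters. -/
noncomputable def ExplicitU2.hostFock (m : ℤ) (c : ℂ) (hc : c ≠ 0) (Lfac : ℂ → ℂ) (τ : Fin 2 → ℤ)
    (ν : Fin 0 → ℤ) (r : ℤ) : N43Places.ExplicitU2 :=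
  ExplicitU2.host N43Fock.FockSpace m N43Fock.fockEmbed c N43Fock.fockEmbed_Delta_ne_zero hc Lfac τ ν r

/-- The Fock model of the fixed compact place is the Fock space with its canonical embedding
(definitional record). -/
theorem ExplicitU2.hostFock_E (m : ℤ) (c : ℂ) (hc : c ≠ 0) (Lfac : ℂ → ℂ) (τ : Fin 2 → ℤ)
    (ν : Fin 0 → ℤ) (r : ℤ) :
    (ExplicitU2.hostFock m c hc Lfac τ ν r).E = N43Fock.FockSpace ∧
    (ExplicitU2.hostFock m c hc Lfac τ ν r).H = U2 ∧
    (ExplicitU2.hostFock m c hc Lfac τ ν r).μ = haarU2 :=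
  ⟨rfl, rfl, rfl⟩

/-- The compact place's Weil-side matrix coefficient on the genuine Fock inner product:
`⟪Δ, ω(g)Δ⟫ = 2 · det(g)^m` for `g ∈ U(2)` (`fockActU2_Delta` + `‖Δ‖² = 2`). -/
theorem hostFock_coeffW (m : ℤ) (c : ℂ) (hc : c ≠ 0) (Lfac : ℂ → ℂ) (τ : Fin 2 → ℤ) (ν : Fin 0 → ℤ)
    (r : ℤ) (g : U2) :
    (ExplicitU2.hostFock m c hc Lfac τ ν r).datum.coeffW g = 2 * (repU2 g).det ^ m := by
  show ⟪N43Fock.fockEmbed Delta, N43Fock.fockEmbed (fockActU2 m (repU2 g) Delta)⟫_ℂ =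
    2 * (repU2 g).det ^ m
  rw [fockActU2_Delta m (repU2_mem g), map_smul, inner_smul_right, N43Fock.inner_fockEmbed_Delta,
    mul_comm]

/-- The compact place's Fock-vector norm on the genuine Fock inner product: `‖Δ‖ = √2`. -/
theorem hostFock_normφ (m : ℤ) (c : ℂ) (hc : c ≠ 0) (Lfac : ℂ → ℂ) (τ : Fin 2 → ℤ) (ν : Fin 0 → ℤ)
    (r : ℤ) : (ExplicitU2.hostFock m c hc Lfac τ ν r).datum.normφ = Real.sqrt 2 :=
  N43Fock.norm_fockEmbed_Delta

/-- The compact place's forced-vector norm on the genuine Fock inner product: `‖f‖ = ‖c Δ‖ = |c| √2`. -/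
theorem hostFock_normf (m : ℤ) (c : ℂ) (hc : c ≠ 0) (Lfac : ℂ → ℂ) (τ : Fin 2 → ℤ) (ν : Fin 0 → ℤ)
    (r : ℤ) : (ExplicitU2.hostFock m c hc Lfac τ ν r).datum.normf = ‖c‖ * Real.sqrt 2 := by
  show ‖N43Fock.fockEmbed (c • Delta)‖ = ‖c‖ * Real.sqrt 2
  rw [map_smul, norm_smul, N43Fock.norm_fockEmbed_Delta]

/-- THEOREM N4.3 (b) at τ′₁ ON THE HOST FOCK MODEL: `Z_{τ′₁}(1/2) = ‖Δ‖² ‖cΔ‖² = 4 |c|²`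
(`zeta_half_eq_U2` — probability Haar measure on `U(2)`, `c₁ = 1` — with the Fock norms explicit). -/
theorem hostFock_zeta_half (m : ℤ) (c : ℂ) (hc : c ≠ 0) (Lfac : ℂ → ℂ) (τ : Fin 2 → ℤ)
    (ν : Fin 0 → ℤ) (r : ℤ) :
    (ExplicitU2.hostFock m c hc Lfac τ ν r).datum.zeta (1 / 2) = ((4 * ‖c‖ ^ 2 : ℝ) : ℂ) := by
  rw [ArchDoublingDatum.zeta_half_eq_U2 _ (ExplicitU2.hostFock m c hc Lfac τ ν r).datum_prob
    (ExplicitU2.hostFock m c hc Lfac τ ν r).datum_characterCoefficient, hostFock_normφ,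
    hostFock_normf]
  congr 1
  rw [mul_pow, Real.sq_sqrt (by norm_num : (0 : ℝ) ≤ 2)]
  ring

/-- The three real places in host shape with the Fock model fixed: the arguments are exactly the
§18(c) choices — `m`, `(c_j, L_j, τ_j, ν_j, r_j)` for `j = 1, 2, 3`. -/
noncomputable def BergmanPlaces.hostFock (m : ℤ) (c₁ : ℂ) (hc₁ : c₁ ≠ 0) (L₁ : ℂ → ℂ)
    (τ₁ : Fin 2 → ℤ) (ν₁ : Fin 0 → ℤ) (r₁ : ℤ) (c₂ : ℂ) (hc₂ : c₂ ≠ 0) (L₂ : ℂ → ℂ) (τ₂ ν₂ : Fin 1 → ℤ)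
    (r₂ : ℤ) (c₃ : ℂ) (hc₃ : c₃ ≠ 0) (L₃ : ℂ → ℂ) (τ₃ ν₃ : Fin 1 → ℤ) (r₃ : ℤ) :
    N43Places.BergmanPlaces :=
  BergmanPlaces.host N43Fock.FockSpace m N43Fock.fockEmbed c₁ N43Fock.fockEmbed_Delta_ne_zero hc₁ L₁
    τ₁ ν₁ r₁ c₂ hc₂ L₂ τ₂ ν₂ r₂ c₃ hc₃ L₃ τ₃ ν₃ r₃

/-- The carriers and measures of the Fock-fixed bundle are the real ones (definitional record):
`H₁ = U(2)`, `H₂ = H₃ = U(1,1)`, `μ₁ = haarU2`, `μ₂ = μ₃ = haarU11`. -/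
theorem BergmanPlaces.hostFock_carriers (m : ℤ) (c₁ : ℂ) (hc₁ : c₁ ≠ 0) (L₁ : ℂ → ℂ)
    (τ₁ : Fin 2 → ℤ) (ν₁ : Fin 0 → ℤ) (r₁ : ℤ) (c₂ : ℂ) (hc₂ : c₂ ≠ 0) (L₂ : ℂ → ℂ) (τ₂ ν₂ : Fin 1 → ℤ)
    (r₂ : ℤ) (c₃ : ℂ) (hc₃ : c₃ ≠ 0) (L₃ : ℂ → ℂ) (τ₃ ν₃ : Fin 1 → ℤ) (r₃ : ℤ) :
    (BergmanPlaces.hostFock m c₁ hc₁ L₁ τ₁ ν₁ r₁ c₂ hc₂ L₂ τ₂ ν₂ r₂ c₃ hc₃ L₃ τ₃ ν₃ r₃).toPlaces.H₁ = U2 ∧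
    (BergmanPlaces.hostFock m c₁ hc₁ L₁ τ₁ ν₁ r₁ c₂ hc₂ L₂ τ₂ ν₂ r₂ c₃ hc₃ L₃ τ₃ ν₃ r₃).toPlaces.H₂ = U11 ∧
    (BergmanPlaces.hostFock m c₁ hc₁ L₁ τ₁ ν₁ r₁ c₂ hc₂ L₂ τ₂ ν₂ r₂ c₃ hc₃ L₃ τ₃ ν₃ r₃).toPlaces.H₃ = U11 ∧
    (BergmanPlaces.hostFock m c₁ hc₁ L₁ τ₁ ν₁ r₁ c₂ hc₂ L₂ τ₂ ν₂ r₂ c₃ hc₃ L₃ τ₃ ν₃ r₃).toPlaces.d₁.μ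
      = haarU2 ∧
    (BergmanPlaces.hostFock m c₁ hc₁ L₁ τ₁ ν₁ r₁ c₂ hc₂ L₂ τ₂ ν₂ r₂ c₃ hc₃ L₃ τ₃ ν₃ r₃).toPlaces.d₂.μ
      = haarU11 ∧
    (BergmanPlaces.hostFock m c₁ hc₁ L₁ τ₁ ν₁ r₁ c₂ hc₂ L₂ τ₂ ν₂ r₂ c₃ hc₃ L₃ τ₃ ν₃ r₃).toPlaces.d₃.μ
      = haarU11 :=
  ⟨rfl, rfl, rfl, rfl, rfl, rfl⟩

/-- THEOREM N4.3 (c) on the Fock-fixed host bundle from the five displays alone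
(`host_archNonvanishing` specialised). -/
theorem hostFock_archNonvanishing (m : ℤ) (c₁ : ℂ) (hc₁ : c₁ ≠ 0) (L₁ : ℂ → ℂ) (τ₁ : Fin 2 → ℤ)
    (ν₁ : Fin 0 → ℤ) (r₁ : ℤ) (c₂ : ℂ) (hc₂ : c₂ ≠ 0) (L₂ : ℂ → ℂ) (τ₂ ν₂ : Fin 1 → ℤ) (r₂ : ℤ)
    (c₃ : ℂ) (hc₃ : c₃ ≠ 0) (L₃ : ℂ → ℂ) (τ₃ ν₃ : Fin 1 → ℤ) (r₃ : ℤ)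
    (hEL₁ : Hyp.EischenLiu2024_Sec2_2 2 0 τ₁ ν₁ r₁ L₁)
    (hA2f₂ : Hyp.Ruhl1970_A2f (BergmanU11.host c₂ hc₂ L₂ τ₂ ν₂ r₂).datum)
    (hEL₂ : Hyp.EischenLiu2024_Sec2_2 1 1 τ₂ ν₂ r₂ L₂)
    (hA2f₃ : Hyp.Ruhl1970_A2f (BergmanU11.host c₃ hc₃ L₃ τ₃ ν₃ r₃).datum)
    (hEL₃ : Hyp.EischenLiu2024_Sec2_2 1 1 τ₃ ν₃ r₃ L₃) :
    (BergmanPlaces.hostFock m c₁ hc₁ L₁ τ₁ ν₁ r₁ c₂ hc₂ L₂ τ₂ ν₂ r₂ c₃ hc₃ L₃ τ₃ ν₃ r₃).toPlaces.ArchNonvanishing :=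
  host_archNonvanishing N43Fock.FockSpace m N43Fock.fockEmbed c₁ N43Fock.fockEmbed_Delta_ne_zero hc₁
    L₁ τ₁ ν₁ r₁ c₂ hc₂ L₂ τ₂ ν₂ r₂ c₃ hc₃ L₃ τ₃ ν₃ r₃ hEL₁ hA2f₂ hEL₂ hA2f₃ hEL₃

/-- The three real places with the Fock model fixed AND the forced vectors normalised to the Fock
vectors themselves (`f_{τ′_j} = φ_{A,τ′_j}`, i.e. `c_j = 1` — R3.7's identification «f ↔ φ», TIER5
(N4.3.P2)): the arguments are `m`, the three L-factors and the Eischen–Liu parameters only. -/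
noncomputable def BergmanPlaces.hostFock₁ (m : ℤ) (L₁ : ℂ → ℂ) (τ₁ : Fin 2 → ℤ) (ν₁ : Fin 0 → ℤ)
    (r₁ : ℤ) (L₂ : ℂ → ℂ) (τ₂ ν₂ : Fin 1 → ℤ) (r₂ : ℤ) (L₃ : ℂ → ℂ) (τ₃ ν₃ : Fin 1 → ℤ) (r₃ : ℤ) :
    N43Places.BergmanPlaces :=
  BergmanPlaces.hostFock m 1 one_ne_zero L₁ τ₁ ν₁ r₁ 1 one_ne_zero L₂ τ₂ ν₂ r₂ 1 one_ne_zero L₃ τ₃ ν₃ r₃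

/-- THEOREM N4.3 (b) at τ′₁ on the normalised host bundle: the local doubling zeta value is the
NUMBER `Z_{τ′₁}(1/2) = 4` (`‖Δ‖² · ‖Δ‖²` on the Fock model, `c₁ = 1`). -/
theorem hostFock₁_zetaAt_zero (m : ℤ) (L₁ : ℂ → ℂ) (τ₁ : Fin 2 → ℤ) (ν₁ : Fin 0 → ℤ) (r₁ : ℤ)
    (L₂ : ℂ → ℂ) (τ₂ ν₂ : Fin 1 → ℤ) (r₂ : ℤ) (L₃ : ℂ → ℂ) (τ₃ ν₃ : Fin 1 → ℤ) (r₃ : ℤ) :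
    (BergmanPlaces.hostFock₁ m L₁ τ₁ ν₁ r₁ L₂ τ₂ ν₂ r₂ L₃ τ₃ ν₃ r₃).toPlaces.zetaAt 0 = 4 := by
  rw [N43Places.zetaAt_zero]
  show (ExplicitU2.hostFock m 1 one_ne_zero L₁ τ₁ ν₁ r₁).datum.zeta (1 / 2) = 4
  rw [hostFock_zeta_half]
  simp

/-- THEOREM N4.3 (c) on the normalised Fock-fixed host bundle from the five displays alone. -/
theorem hostFock₁_archNonvanishing (m : ℤ) (L₁ : ℂ → ℂ) (τ₁ : Fin 2 → ℤ) (ν₁ : Fin 0 → ℤ) (r₁ : ℤ)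
    (L₂ : ℂ → ℂ) (τ₂ ν₂ : Fin 1 → ℤ) (r₂ : ℤ) (L₃ : ℂ → ℂ) (τ₃ ν₃ : Fin 1 → ℤ) (r₃ : ℤ)
    (hEL₁ : Hyp.EischenLiu2024_Sec2_2 2 0 τ₁ ν₁ r₁ L₁)
    (hA2f₂ : Hyp.Ruhl1970_A2f (BergmanU11.host 1 one_ne_zero L₂ τ₂ ν₂ r₂).datum)
    (hEL₂ : Hyp.EischenLiu2024_Sec2_2 1 1 τ₂ ν₂ r₂ L₂)
    (hA2f₃ : Hyp.Ruhl1970_A2f (BergmanU11.host 1 one_ne_zero L₃ τ₃ ν₃ r₃).datum)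
    (hEL₃ : Hyp.EischenLiu2024_Sec2_2 1 1 τ₃ ν₃ r₃ L₃) :
    (BergmanPlaces.hostFock₁ m L₁ τ₁ ν₁ r₁ L₂ τ₂ ν₂ r₂ L₃ τ₃ ν₃ r₃).toPlaces.ArchNonvanishing :=
  hostFock_archNonvanishing m 1 one_ne_zero L₁ τ₁ ν₁ r₁ 1 one_ne_zero L₂ τ₂ ν₂ r₂ 1 one_ne_zero L₃
    τ₃ ν₃ r₃ hEL₁ hA2f₂ hEL₂ hA2f₃ hEL₃

end N43Host

end Summit.Ventures.HodgeRepro2.T6
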